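import Literature.NumberTheory.EllipticCurves.KrausOesterle1992.TorsionCongruenceCriterion
import Literature.NumberTheory.EllipticCurves.SupersingularDensitySerreTraceProofs
import Literature.NumberTheory.EllipticCurves.HidaFamilyMembersProofs
import Literature.NumberTheory.GaloisRepresentations.IntegralGaloisActionProofs
import Mathlib.LinearAlgebra.Trace
import HarnessLib

/-!
# Kraus–Oesterlé 1992, Proposition 3, (i) ⇒ (iii) at the good primes: isomorphic `E[p]`, `E'[p]`
# have congruent traces of Frobenius — proofs, and the composition with Proposition 4 (A30)

Topic `NumberTheory/EllipticCurves`, story `KrausOesterle1992/` (A. Kraus, J. Oesterlé, *Sur une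
question de B. Mazur*, Math. Ann. **293** (1992) 259–275, doi 10.1007/BF01444715; bib
`KrausOesterle1992`). A `Proofs` file: THEOREMS ONLY — nothing is defined, no named fact, no
`sorry`; axioms of every theorem `propext`, `Classical.choice`, `Quot.sound`.

HONEST FRAMING (cell `b2b-bsdres`, run/shared/lean/b2b/bsd-rank1-residual/): the goal of the cell is
to DELETE the COMBINATION-SHAPED residual classes of the Birch–Swinnerton-Dyer formula for ALL
analytic-rank `≤ 1` elliptic curves over `ℚ` from PUBLISHED theorems only; CONSTRUCTION-SHAPED
classes are TYPED, not attempted; this is not "finishing BSD". Literature seat `b2b-bsdres-n1011-lit`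
GEN 36 answering the by-name ask A-O5-G23-2 of o5-r2 GEN 23 (HOME/INBOX.md l.14380 (2)): the END
binder `hcong : O5.IsCongruentModThree W G` — `a_ℓ(W) ≡ a_ℓ(G) (mod 3)` for EVERY prime
`ℓ ∤ 3·N_W·N_G`, with `a_ℓ = WeierstrassCurve.LFunction ℓ` — is to be certified by finitely many
congruences. The finite criterion itself (Prop. 4, (ii) ⇒ (i), irreducible case) is the registered
named fact A30 `KrausOesterle1992.prop4_torsionIso_of_congruences` of the sibling file
`TorsionCongruenceCriterion.lean`, whose conclusion is a `Γ_ℚ`-equivariant isomorphism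
`E[p] ≃ E'[p]`; THIS file proves the remaining, elementary direction of Prop. 3 — an isomorphism of
the mod-`p` representations forces the congruence of traces at every good prime `ℓ ≠ p` — in the
two spellings the tree uses (`frobeniusTrace`, divisibility in `ℤ`; `LFunction`, equality in
`ZMod p`), and composes it with A30.

## The printed statements (PRIMARY read 2026-08-23 on the open GDZ digitisation of Math. Ann. 293,
## PPN235181684_0293, article LOG_0024, scan `NNN` = printed p. `NNN − 6`; OCR text and page-image
## crops deposited at run/shared/lean/b2b/bsd-rank1-residual/b2b-bsdres-n1011-lit/ko92-gdz-ocr/)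

§3, p. 262 (scan 268): "Soient `E` et `E'` deux courbes elliptiques définies sur `ℚ`. Notons `N` et
`N'` leurs conducteurs … Soit `p` un nombre premier. Notons `ρ` et `ρ'` les représentations de
`Gal(ℚ̄/ℚ)` dans les groupes `E_p(ℚ̄)` et `E'_p(ℚ̄)` des points de `p`-torsion de `E` et `E'`"
— NO hypothesis on `p` (the primes `p ∣ NN'`, `p = 2, 3` are in scope).

PROPOSITION 3, p. 262 (scan 268), verbatim: "Les conditions suivantes sont équivalentes: (i) les
représentations `ρ` et `ρ'` ont des semi-simplifiées isomorphes. (ii) L'ensemble des nombres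
premiers `ℓ` tels que `a_ℓ ≡ a'_ℓ mod p` est de densité `1`. (iii) On a `a_ℓ ≡ a'_ℓ mod p` pour
tout nombre premier `ℓ` ne divisant pas `NN'`. On a `a_ℓ a'_ℓ ≡ ℓ + 1 mod p` pour tout nombre
premier `ℓ` tel que `ℓ ∣ NN'` et `ℓ² ∤ NN'`." Its proof of (i) ⇒ (iii), p. 263 (scan 269) top:
"Supposons la condition (i) de la proposition 3 satisfaite. Soit `ℓ` un nombre premier `≠ p`. Si
`ℓ` ne divise pas `NN'`, les représentations `ρ` et `ρ'` sont non ramifiées en `ℓ` et la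
comparaison des traces des éléments de Frobenius en `ℓ` pour ces deux représentations fournit la
congruence `a_ℓ ≡ a'_ℓ mod p`." — exactly `frobeniusTrace_congr_of_addEquiv_geomTorsion` below
(with (i) in the strong form "isomorphic", the form A30 delivers in the irreducible case).

PROPOSITION 4, pp. 263–264 (scans 269–270; the sibling file's module docstring quotes it in full):
for Weil (= modular) curves, with `S` = the primes where one curve is split and the other non-split
multiplicative, `M = ppcm(N, N') ∏_{ℓ∈S} ℓ`, `μ(M) = |ℙ¹(ℤ/Mℤ)| = M ∏_{ℓ∣M} (1 + ℓ⁻¹)`: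
(i) ⟺ (ii) "pour tout nombre premier `ℓ < μ(M)/6` ne divisant pas `NN'`, on a `a_ℓ ≡ a'_ℓ mod p`;
pour tout nombre premier `ℓ < μ(M)/6` tel que `ℓ ∣ NN'` et `ℓ² ∤ NN'`, on a
`a_ℓ a'_ℓ ≡ ℓ + 1 mod p`" (proof via the operators `R_d` and the Sturm-type Proposition of
Appendice II, p. 273).

## What is proved

* `frobeniusTrace_congr_of_addEquiv_geomTorsion` — for globally minimal elliptic `W, G /ℚ`, a prime
  `p` and a `Γ_ℚ`-equivariant additive isomorphism `e : W[p] ≃+ G[p]`: at every prime `ℓ ≠ p` of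
  good reduction for both, `a_ℓ(W) = a_ℓ(G)` in `ZMod p` (`a_ℓ = frobeniusTrace`). Proof: one
  arithmetic Frobenius `σ` above `ℓ` (`primesAbove_nonempty`,
  `exists_isArithFrobAt_of_mem_primesAbove_holds`) has trace `a_ℓ(W) mod p` on `W[p]` and
  `a_ℓ(G) mod p` on `G[p]` (the tree's theorem `trace_galoisRepTorsion_frobenius_eq`, Serre 1981
  (238) / DDT Prop. 2.11 (a)), and `ρ̄_G(σ) = e ∘ ρ̄_W(σ) ∘ e⁻¹` has the trace of `ρ̄_W(σ)`
  (`LinearMap.trace_conj'`).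
* `dvd_frobeniusTrace_sub_of_addEquiv_geomTorsion` — the same as `(p : ℤ) ∣ a_ℓ(W) − a_ℓ(G)`, the
  spelling of `ModPCongruenceIsomorphismProofs` (whose E109 theorems are the converse direction,
  traces ⇒ isomorphism, in the irreducible case).
* `lFunction_congr_of_addEquiv_geomTorsion` — the `LFunction` spelling at every prime
  `ℓ ∤ p·N_W·N_G` (`hasGoodReductionAtPrime_of_not_dvd_conductorNorm`,
  `LFunction_apply_prime_eq_frobeniusTrace`): LITERALLY the hypothesis of A314
  `KrizLi2019.thm116_padicLogHeegner_congruence` and, at `p = 3`, the body of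
  `Summit.….O5.IsCongruentModThree W G`.
* `lFunction_congr_of_prop4` — composition with A30: `W[p]` irreducible and the finite
  Kraus–Oesterlé list of congruences below `μ(M)/6` give `a_ℓ(W) = a_ℓ(G)` in `ZMod p` for every
  prime `ℓ ∤ p·N_W·N_G`. CONDITIONAL on the named fact A30 (binder `hKO`), nothing else.

## What is deliberately NOT here

The two other clauses of (iii) — `a_ℓ a'_ℓ ≡ ℓ + 1` at `ℓ ∥ NN'` (Lemme 1, the Tate curve) and the
case `ℓ = p` (Lemme 2, semi-stable reduction at `p`) — and the density statement (ii) of Prop. 3;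
no consumer asks for them. `-- TODO(general form): Prop. 3 (i) ⇒ (iii) in full, incl. ℓ = p and
ℓ ∥ NN'.` The reducible case of the finite criterion is the PROVED Cremona–Freitas 2022 Thm. 3.6
(`CremonaFreitas2022/ReducibleTorsionCriterion.lean`), not used here.

## References

* A. Kraus, J. Oesterlé, Math. Ann. 293 (1992) 259–275, §3 Prop. 3, Prop. 4. [KrausOesterle1992]
* J.-P. Serre, *Quelques applications du théorème de densité de Chebotarev*, Publ. Math. IHÉS 54
  (1981), §8.1 eq. (238). [Serre1981]
* H. Darmon, F. Diamond, R. Taylor, *Fermat's Last Theorem* (1995), Prop. 2.11 (a).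
  [DarmonDiamondTaylor1995]

## Design

Theorems only; the `ZMod p`-module structure on `E[p]` is Mathlib's `AddSubgroup.torsionBy.zmodModule`
introduced by `letI` inside the proofs (the convention of `SupersingularDensitySerreTraceProofs` and
`ModPCongruenceIsomorphismProofs`); the statements themselves mention no module structure.
-/

noncomputable section

open scoped Classical NumberField
open IsDedekindDomain Field WeierstrassCurve
open Literature.NumberTheory.EllipticCurves Literature.NumberTheory.GaloisRepresentations

namespace Literature.NumberTheory.EllipticCurves.KrausOesterle1992

section TorsionIso

variable (W G : WeierstrassCurve ℚ) [W.IsElliptic] [W.IsGloballyMinimal] [G.IsElliptic]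
  [G.IsGloballyMinimal] (p : ℕ) [Fact p.Prime]

/-- **Kraus–Oesterlé 1992, Proposition 3, (i) ⇒ (iii) at a good prime `ℓ ≠ p`** ("Si `ℓ` ne
divise pas `NN'`, les représentations `ρ` et `ρ'` sont non ramifiées en `ℓ` et la comparaison des
traces des éléments de Frobenius en `ℓ` … fournit la congruence `a_ℓ ≡ a'_ℓ mod p`", p. 263).
Let `W, G /ℚ` be elliptic curves in global minimal form, `p` a prime, and `e : W[p] ≃+ G[p]` a
`Γ_ℚ`-equivariant additive isomorphism of the geometric `p`-torsion (`e (σ • P) = σ • e P`). Then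
at every prime `ℓ ≠ p` at which both curves have good reduction the traces of Frobenius agree
modulo `p`: `a_ℓ(W) = a_ℓ(G)` in `ZMod p`, `a_ℓ = frobeniusTrace` (`= ℓ + 1 − #Ẽ(𝔽_ℓ)`). Proof:
an arithmetic Frobenius `σ` above `ℓ` has trace `a_ℓ mod p` on either plane
(`trace_galoisRepTorsion_frobenius_eq`) and `ρ̄_G(σ)` is the `e`-conjugate of `ρ̄_W(σ)`.
[cite: KrausOesterle1992, §3 Prop. 3 (i) ⇒ (iii) and its proof, Math. Ann. 293 pp. 262–263 (GDZ PPN235181684_0293 scans 268–269)] -/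
theorem frobeniusTrace_congr_of_addEquiv_geomTorsion
    (e : geomTorsion W p ≃+ geomTorsion G p)
    (he : ∀ (σ : absoluteGaloisGroup ℚ) (P : geomTorsion W p), e (σ • P) = σ • e P)
    (ℓ : ℕ) [Fact ℓ.Prime] (hℓp : ℓ ≠ p)
    (hW : W.HasGoodReductionAtPrime ℓ) (hG : G.HasGoodReductionAtPrime ℓ) :
    ((W.frobeniusTrace ℓ : ℤ) : ZMod p) = ((G.frobeniusTrace ℓ : ℤ) : ZMod p) := by
  letI : Module (ZMod p) (geomTorsion W p) := AddSubgroup.torsionBy.zmodModule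
  letI : Module (ZMod p) (geomTorsion G p) := AddSubgroup.torsionBy.zmodModule
  -- the place of `ℚ` at `ℓ`, a prime of `\bar ℤ` above it, an arithmetic Frobenius there
  obtain ⟨v, hv⟩ : ∃ v : HeightOneSpectrum (𝓞 ℚ), (Rat.HeightOneSpectrum.primesEquiv v : ℕ) = ℓ :=
    ⟨Rat.HeightOneSpectrum.primesEquiv.symm ⟨ℓ, Fact.out⟩, by rw [Equiv.apply_symm_apply]⟩
  obtain ⟨𝔓, h𝔓⟩ := v.primesAbove_nonempty
  obtain ⟨σ, hσ⟩ := HeightOneSpectrum.exists_isArithFrobAt_of_mem_primesAbove_holds (v := v) h𝔓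
  -- traces of `σ` on the two planes
  have htrW := W.trace_galoisRepTorsion_frobenius_eq p hℓp hW hv h𝔓 hσ
  have htrG := G.trace_galoisRepTorsion_frobenius_eq p hℓp hG hv h𝔓 hσ
  -- `e` as a `ZMod p`-linear equivalence, conjugating `ρ̄_W(σ)` into `ρ̄_G(σ)`
  let eL : geomTorsion W p ≃ₗ[ZMod p] geomTorsion G p :=
    LinearEquiv.ofBijective (e.toAddMonoidHom.toZModLinearMap p) ⟨e.injective, e.surjective⟩
  have heL : ∀ Q : geomTorsion W p, eL Q = e Q := fun _ ↦ rfl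
  have hconj : (galoisRepTorsion G p σ).toAdd.toAddMonoidHom.toZModLinearMap p =
      eL.conj ((galoisRepTorsion W p σ).toAdd.toAddMonoidHom.toZModLinearMap p) := by
    refine LinearMap.ext fun P ↦ ?_
    obtain ⟨Q, rfl⟩ := eL.surjective P
    rw [LinearEquiv.conj_apply_apply, eL.symm_apply_apply, heL, heL]
    change σ • e Q = e (σ • Q)
    rw [he]
  rw [← htrW, ← htrG, hconj, LinearMap.trace_conj']

/-- The same congruence as a divisibility in `ℤ`: `p ∣ a_ℓ(W) − a_ℓ(G)` at every good prime
`ℓ ≠ p`, given a `Γ_ℚ`-equivariant `W[p] ≃+ G[p]` — the spelling of the hypotheses of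
`ModPCongruenceIsomorphismProofs` (E109: the converse direction, traces ⇒ isomorphism, in the
irreducible case). [cite: KrausOesterle1992, §3 Prop. 3 (i) ⇒ (iii), Math. Ann. 293 pp. 262–263] -/
theorem dvd_frobeniusTrace_sub_of_addEquiv_geomTorsion
    (e : geomTorsion W p ≃+ geomTorsion G p)
    (he : ∀ (σ : absoluteGaloisGroup ℚ) (P : geomTorsion W p), e (σ • P) = σ • e P)
    (ℓ : ℕ) [Fact ℓ.Prime] (hℓp : ℓ ≠ p)
    (hW : W.HasGoodReductionAtPrime ℓ) (hG : G.HasGoodReductionAtPrime ℓ) :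
    (p : ℤ) ∣ W.frobeniusTrace ℓ - G.frobeniusTrace ℓ :=
  (ZMod.intCast_eq_intCast_iff_dvd_sub _ _ p).mp
    (frobeniusTrace_congr_of_addEquiv_geomTorsion W G p e he ℓ hℓp hW hG).symm

/-- **The `LFunction` spelling, at every prime `ℓ ∤ p·N_W·N_G`.** For globally minimal elliptic
`W, G /ℚ` with conductors `N_W = W.conductorNorm ℤ`, `N_G`, a prime `p` and a `Γ_ℚ`-equivariant
additive isomorphism `W[p] ≃+ G[p]`: the Dirichlet coefficients `a_ℓ = WeierstrassCurve.LFunction ℓ`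
satisfy `a_ℓ(W) = a_ℓ(G)` in `ZMod p` for every prime `ℓ` not dividing `p·N_W·N_G` (such `ℓ` are
`≠ p` and of good reduction for both, `hasGoodReductionAtPrime_of_not_dvd_conductorNorm`, where
`a_ℓ` is the trace of Frobenius, `LFunction_apply_prime_eq_frobeniusTrace`). This is literally the
congruence hypothesis of `KrizLi2019.thm116_padicLogHeegner_congruence` and, at `p = 3`, the body
of the cell's `O5.IsCongruentModThree`. Kraus–Oesterlé Prop. 3 (i) ⇒ (iii), first clause, away
from `p`. [cite: KrausOesterle1992, §3 Prop. 3 (i) ⇒ (iii), Math. Ann. 293 pp. 262–263] -/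
theorem lFunction_congr_of_addEquiv_geomTorsion
    (e : geomTorsion W p ≃+ geomTorsion G p)
    (he : ∀ (σ : absoluteGaloisGroup ℚ) (P : geomTorsion W p), e (σ • P) = σ • e P)
    {ℓ : ℕ} (hℓ : ℓ.Prime) (hndvd : ¬ ℓ ∣ p * W.conductorNorm ℤ * G.conductorNorm ℤ) :
    ((W.LFunction ℓ : ℤ) : ZMod p) = ((G.LFunction ℓ : ℤ) : ZMod p) := by
  haveI : Fact ℓ.Prime := ⟨hℓ⟩
  have hℓp : ℓ ≠ p := fun h ↦ hndvd (h ▸ dvd_mul_of_dvd_left (dvd_mul_right ℓ _) _)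
  have hW : W.HasGoodReductionAtPrime ℓ :=
    hasGoodReductionAtPrime_of_not_dvd_conductorNorm W
      fun h ↦ hndvd (dvd_mul_of_dvd_left (dvd_mul_of_dvd_right h p) _)
  have hG : G.HasGoodReductionAtPrime ℓ :=
    hasGoodReductionAtPrime_of_not_dvd_conductorNorm G fun h ↦ hndvd (dvd_mul_of_dvd_right h _)
  rw [W.LFunction_apply_prime_eq_frobeniusTrace ℓ hW, G.LFunction_apply_prime_eq_frobeniusTrace ℓ hG]
  exact frobeniusTrace_congr_of_addEquiv_geomTorsion W G p e he ℓ hℓp hW hG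

end TorsionIso

section WithProp4

/-- **The finite Kraus–Oesterlé criterion, composed: the congruence list of Prop. 4 (ii) below the
bound `μ(M)/6`, for `W[p]` irreducible, gives `a_ℓ(W) ≡ a_ℓ(G) (mod p)` at EVERY prime
`ℓ ∤ p·N_W·N_G`.** CONDITIONAL on the named fact A30 `prop4_torsionIso_of_congruences`
(Prop. 4 (ii) ⇒ (i), irreducible case: binder `hKO`), whose conclusion — a `Γ_ℚ`-equivariant
`W[p] ≃+ G[p]` — is turned into the trace congruences by `lFunction_congr_of_addEquiv_geomTorsion`
(Prop. 3 (i) ⇒ (iii)). Hypotheses exactly as in A30: `W, G` globally minimal, `p` prime,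
`W.HasIrreducibleModPGaloisRep p`, and for all primes `ℓ` with `6ℓ < μ(M)`
(`gammaZeroIndex (modulus W G)`): `p ∣ a_ℓ(W) − a_ℓ(G)` if `v_ℓ(N_W N_G) = 0` and
`p ∣ a_ℓ(W) a_ℓ(G) − (ℓ + 1)` if `v_ℓ(N_W N_G) = 1` (`a_ℓ = frobeniusTrace`).
[cite: KrausOesterle1992, §3 Prop. 4 with Prop. 3 (iii), Math. Ann. 293 pp. 262–264 (GDZ PPN235181684_0293 scans 268–270)] -/
theorem lFunction_congr_of_prop4 (hKO : prop4_torsionIso_of_congruences)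
    (W G : WeierstrassCurve ℚ) [W.IsElliptic] [W.IsGloballyMinimal] [G.IsElliptic]
    [G.IsGloballyMinimal] (p : ℕ) [Fact p.Prime] (hirr : W.HasIrreducibleModPGaloisRep p)
    (hlist : ∀ (ℓ : ℕ) [Fact ℓ.Prime], 6 * ℓ < gammaZeroIndex (modulus W G) →
      (padicValNat ℓ (W.conductorNorm ℤ * G.conductorNorm ℤ) = 0 →
          (p : ℤ) ∣ W.frobeniusTrace ℓ - G.frobeniusTrace ℓ) ∧
        (padicValNat ℓ (W.conductorNorm ℤ * G.conductorNorm ℤ) = 1 →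
          (p : ℤ) ∣ W.frobeniusTrace ℓ * G.frobeniusTrace ℓ - (ℓ + 1))) :
    ∀ ℓ : ℕ, ℓ.Prime → ¬ (ℓ ∣ p * W.conductorNorm ℤ * G.conductorNorm ℤ) →
      ((W.LFunction ℓ : ℤ) : ZMod p) = ((G.LFunction ℓ : ℤ) : ZMod p) := by
  obtain ⟨e, he⟩ := hKO W G p hirr hlist
  exact fun ℓ hℓ hndvd ↦ lFunction_congr_of_addEquiv_geomTorsion W G p e he hℓ hndvd

end WithProp4

end Literature.NumberTheory.EllipticCurves.KrausOesterle1992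

end
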